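import Summits.KontsevichZagierPeriods.KontsevichZagierPeriods.Theorems.HurwitzMicroSectorsNormalFormPrincipleM3EbdBoxSubSimplex
import Summits.KontsevichZagierPeriods.KontsevichZagierPeriods.Theorems.HurwitzMicroSectorsNormalFormPrincipleM3EbdExistsSimplexReps
import Summits.KontsevichZagierPeriods.KontsevichZagierPeriods.Theorems.HurwitzMicroSectorsNormalFormPrincipleM3EbdDualityAndSplits

/-!
# `NormalFormPrinciple` (stmt-KontsevichZagierPeriods-3869), line `SketchIdeator1` —
# leaf `stub_boxRigidity` in DIMENSION THREE: EulerBoxDuality `[(0,1)³, 1/((1−xy)(1−xyz))] ∼ [(0,1)³, 2/(1−xyz)]`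

Assembly file of the first target of the crux idea `m3-equal-value-instances` (strategist gen 2,
`Cruxes/NormalFormPrinciple/M3Instances.lean`, `StrategistGen2.EulerBoxDuality`; lead seat c9,
`--supports` the crux). The two box-rational representations on the open unit box `(0,1)³` have
EQUAL values — `∫ dV/((1−xy)(1−xyz)) = Σ_{k≥1} H_k/k² = ζ(2,1) + ζ(3) = 2ζ(3)` (Euler) — so
Conjecture 1 of Kontsevich–Zagier predicts a chain of moves; the relation-lattice experiment N9
(jobs j022722/j022735) found that it is NOT generated by integrand identities, dilations, box
symmetries and polynomial Newton–Leibniz. Here is the chain (rules (1) and (2) only; no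
independence input):

1. the simplex chart `Φ(x) = (x₀, x₀x₁, x₀x₁x₂)` (rule 2, Jacobian `x₀²x₁`) carries the box onto the
   decreasing open simplex `Δ = {1 > t₀ > t₁ > t₂ > 0}` and the integrand to
   `F = 1/(t₀t₁(1−t₁)(1−t₂))` (`ebd_box_sub_simplex`, generic in the integrand);
2. partial fractions `1/(t₁(1−t₁)) = 1/t₁ + 1/(1−t₁)` (rule 1b): `[Δ, F] = [Δ, G] + [Δ, H]` with
   `G = 1/(t₀t₁(1−t₂))` (the iterated integral `∫ω₀ω₀ω₁ = ζ(3)`) and `H = 1/(t₀(1−t₁)(1−t₂))`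
   (`∫ω₀ω₁ω₁ = ζ(2,1)`) (`ebd_duality_and_splits`, carriers from `ebd_exists_simplexReps`);
3. DUALITY `ζ(2,1) = ζ(3)` as ONE affine move: the involution `t ↦ (1−t₂, 1−t₁, 1−t₀)` of `Δ`
   (rule 2, `|det| = 1`) pulls `G` back to `H` (`ebd_duality_and_splits`);
4. the same chart identifies Beukers' `ζ(3)` box `[(0,1)³, 1/(1−xyz)]` with `[Δ, G]`, and
   `[(0,1)³, 2/(1−xyz)] = 2·[(0,1)³, 1/(1−xyz)]` (rule 1b).

So in weight three duality needs no shuffle machinery: five moves. Sources: M. Kontsevich,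
D. Zagier, *Periods* (2001), §1.2; L. Euler, *Meditationes circa singulare serierum genus* (1776)
(`ζ(2,1) = ζ(3)`); D. Zagier, *Values of zeta functions and their applications* (1994), §9
(duality of MZVs). No definitions are introduced.
-/

noncomputable section

open MeasureTheory Set
open Literature.NumberTheory.Transcendental Literature.NumberTheory.Transcendental.KZ
open Literature.ModelTheory.ExponentialFields (IsSemialgebraic)

namespace Summit.KontsevichZagierPeriods.HurwitzMicroSectors.NormalFormPrinciple.PiBox.M3

/-- **EulerBoxDuality (`StrategistGen2.EulerBoxDuality`, crux idea `m3-equal-value-instances`;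
registered sub-goal `eulerBoxDuality` of stmt-KontsevichZagierPeriods-3869, line `SketchIdeator1`).**
Any representation of `[(0,1)³, 1/((1−xy)(1−xyz))]` is KZ-equivalent to any representation of
`[(0,1)³, 2/(1−xyz)]`: Euler's `ζ(2,1) = ζ(3)` as a chain of five moves of the Kontsevich–Zagier
calculus (simplex chart, partial fractions, the duality involution, chart back, doubling) — an
instance of the leaf `stub_boxRigidity` in dimension three with both sides box-rational and no
transcendence input. [cite: KontsevichZagier2001, §1.2 rules (1), (2)] -/
theorem eulerBoxDuality (r r' : IntegralRep 3)
    (hrd : r.domain = {x | ∀ i, x i ∈ Set.Ioo (0:ℝ) 1})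
    (hri : EqOn r.integrand (fun x => 1 / ((1 - x 0 * x 1) * (1 - x 0 * x 1 * x 2)))
      {x | ∀ i, x i ∈ Set.Ioo (0:ℝ) 1})
    (hr'd : r'.domain = {x | ∀ i, x i ∈ Set.Ioo (0:ℝ) 1})
    (hr'i : EqOn r'.integrand (fun x => 2 / (1 - x 0 * x 1 * x 2)) {x | ∀ i, x i ∈ Set.Ioo (0:ℝ) 1}) :
    Equivalent r r' := by
  obtain ⟨⟨TF, hTFd, hTFi⟩, ⟨TG, hTGd, hTGi⟩, ⟨TH, hTHd, hTHi⟩⟩ :=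
    ebd_exists_simplexReps r hrd (hrd ▸ hri)
  obtain ⟨hdual, hsplit, hdouble, ⟨Z, hZd, hZi⟩⟩ := ebd_duality_and_splits
  -- e1 : `[r] − [TF]`, the simplex chart (pull-back identity = clearing `x₀²x₁`)
  have e1 : of r - of TF ∈ relations := by
    refine ebd_box_sub_simplex (fun t => 1 / (t 0 * t 1 * (1 - t 1) * (1 - t 2))) r TF hrd hTFd
      (hTFi ▸ fun _ _ => rfl) fun x hx => ?_
    have hx' : ∀ i, x i ∈ Set.Ioo (0:ℝ) 1 := by rw [hrd] at hx; exact hx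
    have h0 : x 0 ≠ 0 := (hx' 0).1.ne'
    have h1 : x 1 ≠ 0 := (hx' 1).1.ne'
    have h01 : 1 - x 0 * x 1 ≠ 0 :=
      (sub_pos.2 (mul_lt_one_of_nonneg_of_lt_one_left (hx' 0).1.le (hx' 0).2 (hx' 1).2.le)).ne'
    have h012 : 1 - x 0 * x 1 * x 2 ≠ 0 := by
      have := mul_lt_one_of_nonneg_of_lt_one_left (mul_pos (hx' 0).1 (hx' 1).1).le
        (mul_lt_one_of_nonneg_of_lt_one_left (hx' 0).1.le (hx' 0).2 (hx' 1).2.le) (hx' 2).2.le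
      exact (sub_pos.2 this).ne'
    rw [hri hx']
    simp only [Matrix.cons_val_zero, Matrix.cons_val_one, Matrix.cons_val_two, Matrix.head_cons,
      Matrix.tail_cons]
    field_simp
  -- e2 : `[TF] − [TG] − [TH]` (partial fractions), e3 : `[TH] − [TG]` (duality)
  have e2 : of TF - of TG - of TH ∈ relations :=
    hsplit TF TG TH hTFd (hTFi ▸ fun _ _ => rfl) hTGd (hTGi ▸ fun _ _ => rfl) hTHd
      (hTHi ▸ fun _ _ => rfl)
  have e3 : of TH - of TG ∈ relations :=
    hdual TG TH hTGd (hTGi ▸ fun _ _ => rfl) hTHd (hTHi ▸ fun _ _ => rfl)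
  -- e4 : `[Z] − [TG]`, the same chart on the `ζ(3)` box
  have e4 : of Z - of TG ∈ relations := by
    refine ebd_box_sub_simplex (fun t => 1 / (t 0 * t 1 * (1 - t 2))) Z TG hZd hTGd
      (hTGi ▸ fun _ _ => rfl) fun x hx => ?_
    have hx' : ∀ i, x i ∈ Set.Ioo (0:ℝ) 1 := by rw [hZd] at hx; exact hx
    have h0 : x 0 ≠ 0 := (hx' 0).1.ne'
    have h1 : x 1 ≠ 0 := (hx' 1).1.ne'
    have h012 : 1 - x 0 * x 1 * x 2 ≠ 0 := by
      have := mul_lt_one_of_nonneg_of_lt_one_left (mul_pos (hx' 0).1 (hx' 1).1).le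
        (mul_lt_one_of_nonneg_of_lt_one_left (hx' 0).1.le (hx' 0).2 (hx' 1).2.le) (hx' 2).2.le
      exact (sub_pos.2 this).ne'
    rw [hZi]
    simp only [Matrix.cons_val_zero, Matrix.cons_val_one, Matrix.cons_val_two, Matrix.head_cons,
      Matrix.tail_cons]
    field_simp
  -- e5 : `[r'] − 2[Z]`
  have e5 : of r' - 2 • of Z ∈ relations := hdouble r' Z hr'd (hr'd ▸ hr'i) hZd (hZi ▸ fun _ _ => rfl)
  have e' : of r - of r' =
      (of r - of TF) + (of TF - of TG - of TH) + (of TH - of TG) - 2 • (of Z - of TG)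
        - (of r' - 2 • of Z) := by
    simp only [smul_sub]; abel
  show of r - of r' ∈ relations
  rw [e']
  exact relations.sub_mem (relations.sub_mem (relations.add_mem (relations.add_mem e1 e2) e3)
    (relations.nsmul_mem e4 2)) e5

end Summit.KontsevichZagierPeriods.HurwitzMicroSectors.NormalFormPrinciple.PiBox.M3
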